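import Literature.MathematicalPhysics.QuantumLattice.GrassmannCumulantActionBound
import Literature.MathematicalPhysics.QuantumLattice.GrassmannVacuumBoundDB
import HarnessLib

/-!
# The cumulant bounds for DETERMINANT-BOUNDED covariances (twin of `GrassmannCumulantKernelBound.sum_norm_kernel_cumulantOf_le`,
# `GrassmannLaplacianVacuumBound.norm_constPart_cumulantOf_le`, `GrassmannCumulantActionBound.sum_norm_kernel_cumulantOf_le_pow`)

Topic `MathematicalPhysics/QuantumLattice`; continuation of `GrassmannTruncatedBoundDB` / `GrassmannVacuumBoundDB`.  The kernel and
vacuum bounds for the cumulants `𝓔ᵀ_C(V; n)` (Benfatto–Giuliani–Mastropietro 2006, (2.13)–(2.14) with (2.77)–(2.80)) re-run VERBATIM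
under the replica-stable hypothesis `IsGramBoundedR C κ`: the proofs pass to the replica covariance `C.submatrix Prod.snd Prod.snd` on
`Fin n × Γ`, which is Gram-bounded by `IsGramBoundedR.submatrix` — where a Gram form would pull back trivially, and where the Pedra–
Salmhofer determinant bound needs its weights on rows and columns (`IsDetBoundedR`).

* `norm_constPart_cumulantOf_le_of_gramBounded`, `sum_norm_kernel_cumulantOf_le_of_gramBounded`,
  **`sum_norm_kernel_cumulantOf_le_pow_of_gramBounded`**.

Everything is proved; no definition, no named fact.

## Sources

G. Benfatto, A. Giuliani, V. Mastropietro, Ann. Henri Poincaré 7 (2006) 809–898, (2.13)–(2.14), (2.66)–(2.80)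
[`BenfattoGiulianiMastropietro2006`]; W. de Siqueira Pedra, M. Salmhofer, Comm. Math. Phys. 282 (2008) 797–818, Thm 1.3, Thm 2.4
[`PedraSalmhofer2008`]; K. Gawȩdzki, A. Kupiainen, Comm. Math. Phys. 102 (1985) 1–30 [`GawedzkiKupiainen1985GrossNeveu`].
-/

noncomputable section

namespace Literature.MathematicalPhysics.QuantumLattice

open GrassmannAlgebra Finset MvPolynomial Literature.RingTheory.MvPolynomial
open Literature.Probability.LatticeModels Literature.Probability.LatticeModels.BattleFederbush
open Literature.MeasureTheory.Integral
open scoped InnerProductSpace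

universe u

variable {𝕜 : Type*} [RCLike 𝕜] {Γ : Type u} [Fintype Γ] [DecidableEq Γ] {n : ℕ} (C : Matrix Γ Γ 𝕜)

/-- (Twin of `norm_constPart_cumulantOf_le` under `IsGramBoundedR`.) **The vacuum bound for `𝓔ᵀ_C(V; n)`**: for `V = Σ_{m' ∈ degs} Σ_Y K_{m'}(Y) ψ(Y)` with vanishing degree-`0` kernel
(no constant term), anchored `L¹` norms `≤ N(m')`, a charged Gram covariance with constant `κ`, one-copy row and column
sums of `‖C‖` at most `α`, and any positive `λ_δ`:
`|constPart 𝓔ᵀ_C(V; n)| ≤ n |Γ| · Σ_δ [2(n-1) ≤ N_δ] cumulantBound(δ; r = 0)` (the volume of the pinned root field of the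
`n|Γ|` replica labels). [cite: BenfattoGiulianiMastropietro2006, (2.77)-(2.80)] -/
theorem norm_constPart_cumulantOf_le_of_gramBounded {κ : ℝ} (hκ : 0 ≤ κ) (hGB : IsGramBoundedR C κ)
    (degs : Finset ℕ) (K : (m' : ℕ) → (Fin (2 * m') → Γ) → 𝕜) (hK0 : ∀ Y, K 0 Y = 0) (N : ℕ → ℝ) (hN0 : ∀ m', 0 ≤ N m')
    (hN : ∀ m' (j : Fin (2 * m')) (w : Γ), ∑ Y ∈ univ.filter (fun Y : Fin (2 * m') → Γ => Y j = w), ‖K m' Y‖ ≤ N m')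
    {α : ℝ} (hα : 0 ≤ α) (hrow : ∀ X, ∑ Y, ‖C X Y‖ ≤ α) (hcol : ∀ Y, ∑ X, ‖C X Y‖ ≤ α)
    (lam : (Fin n → ℕ) → ℝ) (hlam : ∀ δ, 0 < lam δ) (hn : 0 < n) :
    ‖constPart 𝕜 ((cumulantOf (fun k => evenGaussConv 𝕜 C (vertexOf 𝕜 degs K ^ k)) n : evenPart 𝕜 Γ) : GrassmannAlgebra 𝕜 Γ)‖ ≤
      ((n : ℝ) * Fintype.card Γ) * ∑ δ ∈ Fintype.piFinset (fun _ : Fin n => degs),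
        (if 2 * (n - 1) ≤ ∑ a, 2 * δ a then cumulantBound n κ α (lam δ) N 0 δ else 0) := by
  set C' : Matrix (Fin n × Γ) (Fin n × Γ) 𝕜 := C.submatrix Prod.snd Prod.snd with hC'
  have huniv : (univ : Finset (Fin n)).Nonempty := ⟨⟨0, hn⟩, mem_univ _⟩
  set U : (Fin n → ℕ) → evenPart 𝕜 (Fin n × Γ) := fun δ => ursellOf (convMoment 𝕜 C'
    (kernelVertex 𝕜 (deg := fun b : Fin n => 2 * δ b) (fun b => even_two_mul (δ b)) fun b => replicaKer 𝕜 (K (δ b)) b)) univ with hU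
  -- replicas, collapse, multilinearity (as in `sum_norm_kernel_cumulantOf_le`)
  have hcum : ((cumulantOf (fun k => evenGaussConv 𝕜 C (vertexOf 𝕜 degs K ^ k)) n : evenPart 𝕜 Γ) : GrassmannAlgebra 𝕜 Γ) =
      ∑ δ ∈ Fintype.piFinset (fun _ : Fin n => degs), collapse 𝕜 (Prod.snd : Fin n × Γ → Γ) (U δ : GrassmannAlgebra 𝕜 (Fin n × Γ)) := by
    have h1 := collapseEven_ursellOf_convMoment_eq_cumulantOf 𝕜 (Prod.snd : Fin n × Γ → Γ) C (replicaVertex 𝕜 degs K)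
      (vertexOf 𝕜 degs K) (collapseEven_replicaVertex 𝕜 degs K) huniv
    rw [card_univ, Fintype.card_fin] at h1
    rw [← h1, coe_collapseEven]
    have h2 : ursellOf (convMoment 𝕜 C' (replicaVertex 𝕜 degs K)) univ = ∑ δ ∈ Fintype.piFinset (fun _ : Fin n => degs), U δ :=
      ursellOf_convMoment_eq_sum_piFinset 𝕜 C' (Prod.fst : Fin n × Γ → Fin n) (fun _ : Fin n => degs)
        (fun a m' => kernelVertex 𝕜 (deg := fun _ : Fin n => 2 * m') (fun _ => even_two_mul m') (fun b => replicaKer 𝕜 (K m') b) a)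
        (fun a m' => coe_kernelVertex_replicaKer_mem 𝕜 m' (K m') a) ⟨0, hn⟩
    rw [← hC', h2, AddSubmonoidClass.coe_finsetSum, map_sum]
  -- transported data
  have hGB' : IsGramBounded C' κ := by rw [hC']; exact (hGB.submatrix Prod.snd).isGramBounded
  -- the bound per degree assignment
  have hδ : ∀ δ : Fin n → ℕ, ‖kernel 𝕜 (U δ : GrassmannAlgebra 𝕜 (Fin n × Γ)) 0 Fin.elim0‖ ≤
      ((n : ℝ) * Fintype.card Γ) * (if 2 * (n - 1) ≤ ∑ a, 2 * δ a then cumulantBound n κ α (lam δ) N 0 δ else 0) := by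
    intro δ
    have hKs : ∀ (v : Fin n) (Yv : Fin (2 * δ v) → Fin n × Γ), replicaKer 𝕜 (K (δ v)) v Yv ≠ 0 → ∀ j, (Yv j).1 = v :=
      fun v Yv h j => replicaKer_support 𝕜 (K (δ v)) v Yv h j
    by_cases hpos : ∃ a, 0 < δ a
    · obtain ⟨a, ha⟩ := hpos
      split_ifs with hle
      · have h := norm_kernel_zero_ursellOf_kernelVertex_le_of_gramBounded C' (Prod.fst : Fin n × Γ → Fin n) (fun b => replicaKer 𝕜 (K (δ b)) b)
          hκ hGB'
          (fun b => even_two_mul (δ b)) hKs (fun u => N (δ u)) (fun u => hN0 _)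
          (fun u j a' => sum_filter_norm_replicaKer_le (K (δ u)) u (hN (δ u)) j a') hα
          (fun ℓ X' => sum_norm_typeRestrict_submatrix_le C hα hrow ℓ X') (fun ℓ Y' => sum_norm_typeRestrict_submatrix_le' C hα hcol ℓ Y')
          (hlam δ) a ⟨0, by omega⟩
        rw [hU]
        refine h.trans (le_of_eq ?_)
        rw [Fintype.card_prod, Fintype.card_fin, Nat.cast_mul, cumulantBound, Nat.factorial_zero, Nat.cast_one, inv_one, one_mul,
          Nat.descFactorial_zero, Nat.cast_one, one_mul, zero_add]
      · rw [hU]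
        dsimp only
        rw [kernel_ursellOf_kernelVertex_eq_zero_of_lt_of_gramBounded C' (Prod.fst : Fin n × Γ → Fin n) (fun b => replicaKer 𝕜 (K (δ b)) b)
          hκ hGB'
          (fun b => even_two_mul (δ b)) hKs ⟨0, hn⟩ (by omega) Fin.elim0, norm_zero, mul_zero]
    · -- all degrees vanish: the vertices are the zero kernel
      have hδ0 : ∀ a, δ a = 0 := fun a => Nat.eq_zero_of_not_pos fun h => hpos ⟨a, h⟩
      have hzero : U δ = 0 := by
        rw [hU]
        refine ursellOf_convMoment_eq_zero_of_eq_zero C' (Prod.fst : Fin n × Γ → Fin n)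
          (fun b => coe_kernelVertex_mem 𝕜 Prod.fst _ _ hKs b) (v₀ := ⟨0, hn⟩) ?_
        rw [kernelVertex]
        refine sum_eq_zero fun Yv _ => ?_
        have hK' : replicaKer 𝕜 (K (δ ⟨0, hn⟩)) ⟨0, hn⟩ Yv = 0 := by
          rw [replicaKer]
          split_ifs
          · generalize hm : δ ⟨0, hn⟩ = m at Yv
            rw [hδ0] at hm
            subst hm
            exact hK0 _
          · rfl
        rw [hK', zero_smul]
      rw [hzero, ZeroMemClass.coe_zero, kernel_zero_right, norm_zero]
      refine mul_nonneg (by positivity) ?_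
      split_ifs
      · exact cumulantBound_nonneg hκ hα (hlam δ) (fun m' => hN0 m') 0 δ
      · exact le_rfl
  -- assemble
  calc ‖constPart 𝕜 ((cumulantOf (fun k => evenGaussConv 𝕜 C (vertexOf 𝕜 degs K ^ k)) n : evenPart 𝕜 Γ) : GrassmannAlgebra 𝕜 Γ)‖
      ≤ ∑ δ ∈ Fintype.piFinset (fun _ : Fin n => degs), ‖kernel 𝕜 (U δ : GrassmannAlgebra 𝕜 (Fin n × Γ)) 0 Fin.elim0‖ := by
        rw [hcum, map_sum]
        refine (norm_sum_le _ _).trans (le_of_eq (sum_congr rfl fun δ _ => ?_))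
        rw [constPart_collapse, kernel_zero]
    _ ≤ ∑ δ ∈ Fintype.piFinset (fun _ : Fin n => degs),
          ((n : ℝ) * Fintype.card Γ) * (if 2 * (n - 1) ≤ ∑ a, 2 * δ a then cumulantBound n κ α (lam δ) N 0 δ else 0) :=
        sum_le_sum fun δ _ => hδ δ
    _ = ((n : ℝ) * Fintype.card Γ) * ∑ δ ∈ Fintype.piFinset (fun _ : Fin n => degs),
          (if 2 * (n - 1) ≤ ∑ a, 2 * δ a then cumulantBound n κ α (lam δ) N 0 δ else 0) := by rw [mul_sum]

/-- (Twin of `sum_norm_kernel_cumulantOf_le` under `IsGramBoundedR`.) **The `L¹–L^∞` bound for the kernels of `𝓔ᵀ_C(V; n)`** (Benfatto–Giuliani–Mastropietro 2006, (2.13)–(2.14)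
with (2.77)–(2.80); Gawȩdzki–Kupiainen 1985): for `V = Σ_{m' ∈ degs} Σ_Y K_{m'}(Y) ψ(Y)` with anchored `L¹`
norms `≤ N(m')`, a charged covariance in Gram form on the mixed pairs with constant `κ` and one-copy row and
column sums of `‖C‖` at most `α`, and any positive `λ_δ` (it may depend on the degree assignment; the choice
`λ_δ = 1/(α (N_δ + n))` makes `λ_δ^{-(n-1)} ∏_ℓ (1 + λ_δ α (2δ)(2δ')_ℓ) ≤ (n-1)! (eα)^{n-1} e ∏_a e^{3δ_a}`): one output
label pinned and the others summed, `Σ_{W : W_i = w} ‖kernel_r 𝓔ᵀ_C(V; n) (W)‖ ≤ n · Σ_δ cumulantBound(δ)` (the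
factor `n`: the copy of the pinned label) — no `n!` beyond the `(n-1)!` cancelled by the `1/n!` of the cumulant series.
[cite: BenfattoGiulianiMastropietro2006, (2.13)-(2.14) and (2.77)-(2.80)] -/
theorem sum_norm_kernel_cumulantOf_le_of_gramBounded {κ : ℝ} (hκ : 0 ≤ κ) (hGB : IsGramBoundedR C κ)
    (degs : Finset ℕ) (K : (m' : ℕ) → (Fin (2 * m') → Γ) → 𝕜) (N : ℕ → ℝ) (hN0 : ∀ m', 0 ≤ N m')
    (hN : ∀ m' (j : Fin (2 * m')) (w : Γ), ∑ Y ∈ univ.filter (fun Y : Fin (2 * m') → Γ => Y j = w), ‖K m' Y‖ ≤ N m')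
    {α : ℝ} (hα : 0 ≤ α) (hrow : ∀ X, ∑ Y, ‖C X Y‖ ≤ α) (hcol : ∀ Y, ∑ X, ‖C X Y‖ ≤ α)
    (lam : (Fin n → ℕ) → ℝ) (hlam : ∀ δ, 0 < lam δ) (hn : 0 < n) {r : ℕ} (i : Fin r) (w : Γ) :
    ∑ W ∈ univ.filter (fun W : Fin r → Γ => W i = w),
        ‖kernel 𝕜 ((cumulantOf (fun k => evenGaussConv 𝕜 C (vertexOf 𝕜 degs K ^ k)) n : evenPart 𝕜 Γ) : GrassmannAlgebra 𝕜 Γ) r W‖ ≤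
      (n : ℝ) * ∑ δ ∈ Fintype.piFinset (fun _ : Fin n => degs),
        (if r + 2 * (n - 1) ≤ ∑ a, 2 * δ a then cumulantBound n κ α (lam δ) N r δ else 0) := by
  set C' : Matrix (Fin n × Γ) (Fin n × Γ) 𝕜 := C.submatrix Prod.snd Prod.snd with hC'
  have huniv : (univ : Finset (Fin n)).Nonempty := ⟨⟨0, hn⟩, mem_univ _⟩
  -- the degree-`δ` replica families
  set U : (Fin n → ℕ) → evenPart 𝕜 (Fin n × Γ) := fun δ => ursellOf (convMoment 𝕜 C'
    (kernelVertex 𝕜 (deg := fun b : Fin n => 2 * δ b) (fun b => even_two_mul (δ b)) fun b => replicaKer 𝕜 (K (δ b)) b)) univ with hU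
  -- replicas, collapse and multilinearity
  have hcum : ((cumulantOf (fun k => evenGaussConv 𝕜 C (vertexOf 𝕜 degs K ^ k)) n : evenPart 𝕜 Γ) : GrassmannAlgebra 𝕜 Γ) =
      ∑ δ ∈ Fintype.piFinset (fun _ : Fin n => degs), collapse 𝕜 (Prod.snd : Fin n × Γ → Γ) (U δ : GrassmannAlgebra 𝕜 (Fin n × Γ)) := by
    have h1 := collapseEven_ursellOf_convMoment_eq_cumulantOf 𝕜 (Prod.snd : Fin n × Γ → Γ) C (replicaVertex 𝕜 degs K)
      (vertexOf 𝕜 degs K) (collapseEven_replicaVertex 𝕜 degs K) huniv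
    rw [card_univ, Fintype.card_fin] at h1
    rw [← h1, coe_collapseEven]
    have h2 : ursellOf (convMoment 𝕜 C' (replicaVertex 𝕜 degs K)) univ = ∑ δ ∈ Fintype.piFinset (fun _ : Fin n => degs), U δ := by
      have h := ursellOf_convMoment_eq_sum_piFinset 𝕜 C' (Prod.fst : Fin n × Γ → Fin n) (fun _ : Fin n => degs)
        (fun a m' => kernelVertex 𝕜 (deg := fun _ : Fin n => 2 * m') (fun _ => even_two_mul m') (fun b => replicaKer 𝕜 (K m') b) a)
        (fun a m' => coe_kernelVertex_replicaKer_mem 𝕜 m' (K m') a) ⟨0, hn⟩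
      exact h
    rw [← hC', h2, AddSubmonoidClass.coe_finsetSum, map_sum]
  -- the bound per degree assignment and pinned copy
  have hδ : ∀ (δ : Fin n → ℕ) (b : Fin n), ∑ W' ∈ univ.filter (fun W' : Fin r → Fin n × Γ => W' i = (b, w)),
      ‖kernel 𝕜 (U δ : GrassmannAlgebra 𝕜 (Fin n × Γ)) r W'‖ ≤ if r + 2 * (n - 1) ≤ ∑ a, 2 * δ a then cumulantBound n κ α (lam δ) N r δ else 0 := by
    intro δ b
    have hGB' : IsGramBounded C' κ := by rw [hC']; exact (hGB.submatrix Prod.snd).isGramBounded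
    have hKs : ∀ (v : Fin n) (Yv : Fin (2 * δ v) → Fin n × Γ), replicaKer 𝕜 (K (δ v)) v Yv ≠ 0 → ∀ j, (Yv j).1 = v :=
      fun v Yv h j => replicaKer_support 𝕜 (K (δ v)) v Yv h j
    split_ifs with hle
    · exact sum_norm_kernel_ursellOf_kernelVertex_le_of_gramBounded C' (Prod.fst : Fin n × Γ → Fin n) (fun b => replicaKer 𝕜 (K (δ b)) b)
        hκ hGB'
        (fun b => even_two_mul (δ b)) hKs (fun u => N (δ u)) (fun u => hN0 _)
        (fun u j a' => sum_filter_norm_replicaKer_le (K (δ u)) u (hN (δ u)) j a') hα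
        (fun ℓ X' => sum_norm_typeRestrict_submatrix_le C hα hrow ℓ X') (fun ℓ Y' => sum_norm_typeRestrict_submatrix_le' C hα hcol ℓ Y')
        (hlam δ) i (b, w)
    · refine le_of_eq (sum_eq_zero fun W' _ => ?_)
      rw [hU]
      dsimp only
      rw [kernel_ursellOf_kernelVertex_eq_zero_of_lt_of_gramBounded C' (Prod.fst : Fin n × Γ → Fin n) (fun b => replicaKer 𝕜 (K (δ b)) b)
        hκ hGB'
        (fun b => even_two_mul (δ b)) hKs ⟨0, hn⟩ (not_le.1 hle) W', norm_zero]
  -- assemble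
  calc ∑ W ∈ univ.filter (fun W : Fin r → Γ => W i = w),
          ‖kernel 𝕜 ((cumulantOf (fun k => evenGaussConv 𝕜 C (vertexOf 𝕜 degs K ^ k)) n : evenPart 𝕜 Γ) : GrassmannAlgebra 𝕜 Γ) r W‖
      ≤ ∑ W ∈ univ.filter (fun W : Fin r → Γ => W i = w), ∑ δ ∈ Fintype.piFinset (fun _ : Fin n => degs),
          ‖kernel 𝕜 (collapse 𝕜 (Prod.snd : Fin n × Γ → Γ) (U δ : GrassmannAlgebra 𝕜 (Fin n × Γ))) r W‖ := by
        refine sum_le_sum fun W _ => ?_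
        rw [hcum, kernel_sum]
        exact norm_sum_le _ _
    _ = ∑ δ ∈ Fintype.piFinset (fun _ : Fin n => degs), ∑ W ∈ univ.filter (fun W : Fin r → Γ => W i = w),
          ‖kernel 𝕜 (collapse 𝕜 (Prod.snd : Fin n × Γ → Γ) (U δ : GrassmannAlgebra 𝕜 (Fin n × Γ))) r W‖ := sum_comm
    _ ≤ ∑ δ ∈ Fintype.piFinset (fun _ : Fin n => degs), ∑ _b : Fin n,
          (if r + 2 * (n - 1) ≤ ∑ a, 2 * δ a then cumulantBound n κ α (lam δ) N r δ else 0) :=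
        sum_le_sum fun δ _ => (sum_filter_norm_kernel_collapse_le _ i w).trans (sum_le_sum fun b _ => hδ δ b)
    _ = (n : ℝ) * ∑ δ ∈ Fintype.piFinset (fun _ : Fin n => degs),
          (if r + 2 * (n - 1) ≤ ∑ a, 2 * δ a then cumulantBound n κ α (lam δ) N r δ else 0) := by
        rw [mul_sum]
        exact sum_congr rfl fun δ _ => by rw [sum_const, card_univ, Fintype.card_fin, nsmul_eq_mul]

/-- (Twin of `sum_norm_kernel_cumulantOf_le_pow` under `IsGramBoundedR`.) **`‖𝓔ᵀ_C(V; n)‖ ≤ n! Cⁿ ‖V‖_hⁿ` with explicit constants** (Benfatto–Giuliani–Mastropietro 2006, (2.77)–(2.80);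
Gawȩdzki–Kupiainen 1985): for `V = Σ_{m' ∈ degs} Σ_Y K_{m'}(Y) ψ(Y)` (degrees `2m'`, anchored `L¹` norms `≤ N(m')`),
a charged covariance in Gram form on the mixed pairs with constant `κ > 0` and one-copy row and column sums of
`‖C‖` at most `α > 0`, and an output field weight `ρ > 0`: one output label pinned and the others summed,
`Σ_{W : W_i = w} ‖kernel_r 𝓔ᵀ_C(V; n) (W)‖ ≤ n! · ρ^{-r} κ^{-2(n-1)} α^{n-1} eⁿ · (Σ_{m'} (e²(κ+ρ))^{2m'} N(m'))ⁿ`.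
[cite: BenfattoGiulianiMastropietro2006, (2.77)-(2.80)] -/
theorem sum_norm_kernel_cumulantOf_le_pow_of_gramBounded {κ : ℝ} (hκ : 0 < κ) (hGB : IsGramBoundedR C κ)
    (degs : Finset ℕ) (K : (m' : ℕ) → (Fin (2 * m') → Γ) → 𝕜) (N : ℕ → ℝ) (hN0 : ∀ m', 0 ≤ N m')
    (hN : ∀ m' (j : Fin (2 * m')) (w : Γ), ∑ Y ∈ univ.filter (fun Y : Fin (2 * m') → Γ => Y j = w), ‖K m' Y‖ ≤ N m')
    {α : ℝ} (hα : 0 < α) (hrow : ∀ X, ∑ Y, ‖C X Y‖ ≤ α) (hcol : ∀ Y, ∑ X, ‖C X Y‖ ≤ α) {ρ : ℝ} (hρ : 0 < ρ)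
    (hn : 0 < n) {r : ℕ} (i : Fin r) (w : Γ) :
    ∑ W ∈ univ.filter (fun W : Fin r → Γ => W i = w),
        ‖kernel 𝕜 ((cumulantOf (fun k => evenGaussConv 𝕜 C (vertexOf 𝕜 degs K ^ k)) n : evenPart 𝕜 Γ) : GrassmannAlgebra 𝕜 Γ) r W‖ ≤
      (n.factorial : ℝ) * (ρ⁻¹ ^ r * κ⁻¹ ^ (2 * (n - 1)) * (α ^ (n - 1) * Real.exp n)) *
        (∑ m' ∈ degs, (Real.exp 2 * (κ + ρ)) ^ (2 * m') * N m') ^ n := by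
  have h := sum_norm_kernel_cumulantOf_le_of_gramBounded C hκ.le hGB degs K N hN0 hN hα.le hrow hcol
    (fun δ => (α * ((∑ a, (2 * δ a : ℝ)) + n))⁻¹) (fun δ => by positivity) hn i w
  refine h.trans ?_
  set c : ℝ := ρ⁻¹ ^ r * κ⁻¹ ^ (2 * (n - 1)) * (((n - 1).factorial : ℝ) * α ^ (n - 1) * Real.exp n) with hc
  -- every degree assignment
  have hterm : ∀ δ : Fin n → ℕ,
      (if r + 2 * (n - 1) ≤ ∑ a, 2 * δ a then cumulantBound n κ α ((α * ((∑ a, (2 * δ a : ℝ)) + n))⁻¹) N r δ else 0) ≤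
        c * ∏ a, (Real.exp 2 * (κ + ρ)) ^ (2 * δ a) * N (δ a) := by
    intro δ
    have hP : 0 ≤ ∏ a, (Real.exp 2 * (κ + ρ)) ^ (2 * δ a) * N (δ a) := prod_nonneg fun a _ => mul_nonneg (by positivity) (hN0 _)
    split_ifs with hle
    · rw [cumulantBound]
      have hA := choose_mul_pow_le (N := ∑ a, 2 * δ a) (r := r) (m := 2 * (n - 1)) hle hκ hρ
      have hT := treeFactor_choice_le hn δ hα
      have hNprod : 0 ≤ ∏ a, N (δ a) := prod_nonneg fun a _ => hN0 _
      have hTnonneg : 0 ≤ ((α * ((∑ a, (2 * δ a : ℝ)) + n))⁻¹)⁻¹ ^ (n - 1) *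
          ∏ ℓ : Sym2 (Fin n), (1 + (α * ((∑ a, (2 * δ a : ℝ)) + n))⁻¹ * (α * (pairDeg (fun a => 2 * δ a) ℓ : ℝ))) := by
        have hs : 0 ≤ ∑ a, (2 * δ a : ℝ) := sum_nonneg fun a _ => by positivity
        exact mul_nonneg (by positivity) (prod_nonneg fun ℓ _ => by positivity)
      calc ((((r.factorial : ℝ))⁻¹ * ((∑ a, 2 * δ a).descFactorial r : ℝ)) * κ ^ ((∑ a, 2 * δ a) - (r + 2 * (n - 1))) * ∏ a, N (δ a)) *
            (((α * ((∑ a, (2 * δ a : ℝ)) + n))⁻¹)⁻¹ ^ (n - 1) *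
              ∏ ℓ : Sym2 (Fin n), (1 + (α * ((∑ a, (2 * δ a : ℝ)) + n))⁻¹ * (α * (pairDeg (fun a => 2 * δ a) ℓ : ℝ))))
          ≤ ((ρ⁻¹ ^ r * κ⁻¹ ^ (2 * (n - 1)) * (κ + ρ) ^ (∑ a, 2 * δ a)) * ∏ a, N (δ a)) *
              (((n - 1).factorial : ℝ) * α ^ (n - 1) * Real.exp (2 * (∑ a, (2 * δ a : ℝ)) + n)) :=
            mul_le_mul (mul_le_mul_of_nonneg_right hA hNprod) hT hTnonneg (by positivity)
        _ = c * ∏ a, (Real.exp 2 * (κ + ρ)) ^ (2 * δ a) * N (δ a) := by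
            have hexp : Real.exp (2 * (∑ a, (2 * δ a : ℝ)) + n) = Real.exp n * ∏ a, Real.exp 2 ^ (2 * δ a) := by
              rw [Real.exp_add, mul_comm, mul_sum, Real.exp_sum]
              congr 1
              refine prod_congr rfl fun a _ => ?_
              rw [← Real.exp_nat_mul]
              congr 1
              push_cast
              ring
            rw [hexp, ← prod_pow_eq_pow_sum, hc]
            simp only [mul_pow, prod_mul_distrib]
            ring
    · exact mul_nonneg (by positivity) hP
  -- sum over the degree assignments
  calc (n : ℝ) * ∑ δ ∈ Fintype.piFinset (fun _ : Fin n => degs),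
          (if r + 2 * (n - 1) ≤ ∑ a, 2 * δ a then cumulantBound n κ α ((α * ((∑ a, (2 * δ a : ℝ)) + n))⁻¹) N r δ else 0)
      ≤ (n : ℝ) * ∑ δ ∈ Fintype.piFinset (fun _ : Fin n => degs), c * ∏ a, (Real.exp 2 * (κ + ρ)) ^ (2 * δ a) * N (δ a) :=
        mul_le_mul_of_nonneg_left (sum_le_sum fun δ _ => hterm δ) (Nat.cast_nonneg n)
    _ = (n.factorial : ℝ) * (ρ⁻¹ ^ r * κ⁻¹ ^ (2 * (n - 1)) * (α ^ (n - 1) * Real.exp n)) *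
          (∑ m' ∈ degs, (Real.exp 2 * (κ + ρ)) ^ (2 * m') * N m') ^ n := by
        rw [← mul_sum, sum_piFinset_prod_eq_pow degs fun m' => (Real.exp 2 * (κ + ρ)) ^ (2 * m') * N m', hc,
          ← Nat.mul_factorial_pred (Nat.pos_iff_ne_zero.1 hn), Nat.cast_mul]
        ring

end Literature.MathematicalPhysics.QuantumLattice

end
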